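import Mathlib.NumberTheory.NumberField.InfinitePlace.Embeddings
import Mathlib.Algebra.Module.ZLattice.Covolume
import Mathlib.Analysis.SpecialFunctions.Log.Basic
import Literature.NumberTheory.EllipticCurves.ComplexPeriodProofs
import Literature.NumberTheory.EllipticCurves.ModularCurve
import Literature.NumberTheory.EllipticCurves.ModularDegreeFormulaProofs
import Literature.NumberTheory.EllipticCurves.GlobalMinimalModel
import Literature.NumberTheory.EllipticCurves.Isogeny
import Literature.NumberTheory.DiophantineGeometry.MinimalDiscriminant
import Literature.NumberTheory.DiophantineGeometry.MinimalDiscriminantSmulProofs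
import Literature.NumberTheory.DiophantineGeometry.MinimalDiscriminantRingOfIntegersProofs
import Literature.NumberTheory.DiophantineGeometry.EllArithGlueProofs
import Literature.NumberTheory.DiophantineGeometry.AVIsogenyFlat
import Literature.NumberTheory.DiophantineGeometry.AVGaloisModule
import Literature.AlgebraicGeometry.Motives.AbelianVarietyProduct
import Literature.AlgebraicGeometry.Motives.AbelianVarietyProjective
import HarnessLib

/-!
# The Faltings height

Topic `NumberTheory/DiophantineGeometry` (definition request `defn-faltingsHeight`, wanted by
route ABC/IsogenyGlueCongruence, item K1 `TorsionSharingPrimeBound`, and by the height-conjecture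
items of ABC: Frey's height conjecture `h(E) < κ log N_E`, Pasten 2024 Conj. 3.1).

## The notion and its normalisation (pinned)

Faltings (Invent. Math. 73 (1983), §3; English translation in Cornell–Silverman, Ch. II, §3):
for a number field `K` with integers `R`, a *metrized line bundle* on `Spec R` is a projective
rank-one `R`-module `P` with norms at the infinite places, of degree
`deg(P) = log #(P / R·p) − Σ_v ε_v log ‖p‖_v` (`p ∈ P` non-zero, `ε_v = 1, 2` at real, complex
`v`; equivalently the sum runs over all embeddings `σ : K → ℂ`). For a semiabelian `𝒜 → Spec R`
with proper generic fibre `A` (e.g. the Néron model of an abelian variety with semistable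
reduction) the Hodge bundle `ω_{𝒜/R} = ε^* Ω^g_{𝒜/R}` is metrized by
**`‖α‖²_σ = (i/2)^g ∫_{A_σ(ℂ)} α ∧ ᾱ`** and the height is **`h(A) = [K:ℚ]⁻¹ · deg ω_{𝒜/R}`**,
"invariant under extension of the ground field" — the **stable Faltings height `h_F(A)`**. The
same recipe with the Néron model of `A/K` itself (semistable or not) is the height `h(A/K)` of
`A` *over `K`* (Silverman 1986, §1; Pasten 2024, §3 and §18.1: "this is not the semi-stable
Faltings height"), which can drop under base change and agrees with `h_F(A)` as soon as `A/K` is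
semistable. This is the *original normalisation of Faltings*, the one of Silverman 1986,
Pasten 2024 and Gaudron–Rémond 2023 (§1.5: "avec la normalisation initiale de Faltings"); the
Bost–Deligne normalisation `h(A)` of Gaudron–Rémond 2014 (Def. 2.1, metric `(2π)^{-g} ∫ |α ∧ ᾱ|`)
differs from it by `h_F(A) = h(A) − (g/2) log π` (loc. cit.).

## What is defined (real definitions) — elliptic curves

Mathlib has neither Néron models with their Hodge bundle nor integration of holomorphic forms on
`A(ℂ)`, so the general definition is out of reach; for **elliptic curves** the height is an
explicit, model-independent closed formula, which we take as the definition. Computing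
`deg ω^{⊗12}` with Silverman's coordinate-invariant section `β = Δ · ω^{⊗12}`
(`ω = dx/(2y + a₁x + a₃)` the differential of *any* Weierstrass model `W` of `E/K`; Silverman
1986, proof of Prop. 1.1): at a finite place `v`, `β = Δ_v α_v^{⊗12}` for the differential `α_v`
of a minimal model at `v`, a generator of `ω_{𝒩/R_v}`, so the finite places contribute
`log N_{K/ℚ}(𝔇_min)` (the minimal discriminant ideal); at `σ : K → ℂ`,
`‖β‖_σ = |σ(Δ_W)| · ‖ω_W‖_σ^{12}` with `‖ω_W‖²_σ = (i/2)∫_{E_σ(ℂ)} ω ∧ ω̄ = covol(Λ_{W,σ})`, the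
Lebesgue covolume of the period lattice of `ω_W` under `σ`. Hence

  `12 [K:ℚ] · h(E/K) = log N(𝔇_min(E/K)) − Σ_{σ : K → ℂ} ( log |σ(Δ_W)| + 6 log covol(Λ_{W,σ}) )`,

which is Silverman's `[K:ℚ] h(E/K) = (1/12){ log|N Δ_{E/K}| − Σ_v n_v log(|Δ(τ_v)| Im(τ_v)⁶) }`
(Prop. 1.1, with `Δ(τ) = (2π)^{12} q ∏(1−qⁿ)^{24}`; Pasten 2024, (18.1), writes the same formula
with the `q`-normalised `Δ` and the resulting `− log(2π)`). In the tree `covol(Λ_{W,σ})` is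
`(W.map σ).complexPeriod / 2` (`WeierstrassCurve.complexPeriod = ∫_{E(ℂ)} |ω ∧ ω̄| = 2 covol`,
`ComplexPeriod.lean`) and `N(𝔇_min)` is `W.minimalDiscriminantNorm (𝓞 K)`
(`MinimalDiscriminant.lean`).

* `WeierstrassCurve.faltingsArchTerm V` (`V` over `ℂ`): `log |Δ_V| + 6 log((i/2)∫ ω_V ∧ ω̄_V)`,
  invariant under changes of variables (`faltingsArchTerm_smul`, proved).
* `WeierstrassCurve.faltingsHeight W` (`W` elliptic over a number field `K`): `h(E/K)` by the
  displayed formula; model-independent (`faltingsHeight_smul`, proved).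
* `WeierstrassCurve.jDenominatorIdeal W`: the denominator ideal `𝔇` of `j(E)`, `(j) = 𝔄𝔇⁻¹`
  (Silverman 1986, §2): `𝔇 = Δ_{E/K}` when `E/K` is semistable and `𝔇 ∣ Δ_{E/K}` always, the
  quotient being the *unstable minimal discriminant*; over an extension `L/K` where `E` acquires
  semistable reduction `𝔇_{E_L/L} = 𝔇 O_L`, so `[L:ℚ]⁻¹ log N(𝔇_min(E_L/L)) = [K:ℚ]⁻¹ log N(𝔇)`.
* `WeierstrassCurve.stableFaltingsHeight W`: the stable height `h_F(E) = h(E_L/L)` (`L` as above),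
  i.e. the same formula with `N(𝔇)` in place of `N(𝔇_min)`; model-independent
  (`stableFaltingsHeight_smul`, proved).
* Over `ℚ`, for a globally minimal model (`[W.IsGloballyMinimal]`, so `N(𝔇_min) = |Δ_W|`):
  `faltingsHeight_eq_neg_half_log` (`h(E) = −½ log((i/2)∫_{E(ℂ)} ω ∧ ω̄)`, Pasten 2024 §3,
  proved), `faltingsHeight_eq_neg_half_log_covolume` (`= −½ log covol(Λ_E)` for every Néron-type
  period pair, `IsNeronLatticeOf`), `ModularParametrizationData.faltingsHeight_eq` (the same for
  the lattice `D.L` of a modular parametrisation datum) and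
  `ModularParametrizationData.two_mul_faltingsHeight_eq` (Frey's identity
  `log deg φ = 2 log(2π c) + 2 log ‖f‖ + 2 h(E)` from Zagier's formula, proved in the tree).

## Named facts (D-0014), elliptic curves

* `WeierstrassCurve.log_minimalDiscriminantNorm_lt_faltingsHeight`:
  `[K:ℚ]⁻¹ log N(𝔇_min) < 12 h(E/K) + 16` (Pasten 2024, Lemma 18.1, from Silverman 1986 §2).
* `WeierstrassCurve.stableFaltingsHeight_le_of_isogeny`: `h_F(E') ≤ h_F(E) + ½ log deg φ` for an
  isogeny `φ : E → E'` (Faltings 1983, Lemma 5; Gaudron–Rémond 2014, §2.3).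
* `WeierstrassCurve.stableFaltingsHeight_map`: invariance of `h_F` under finite extension of the
  base field (Faltings 1983, §3).

## Abelian varieties of arbitrary dimension: an interface

`Literature.NumberTheory.DiophantineGeometry.FaltingsHeightTheory` is a **hypothesis structure**
(CONVENTIONS §9): a function `hF` on abelian varieties over number fields
(`Literature.AlgebraicGeometry.Motives.AbelianVariety`) together with the properties of the stable
Faltings height that statements consume, each cited — invariance under isomorphism and base
change, Faltings' isogeny inequality `hF B ≤ hF A + ½ log deg φ` (degree = `Hom.kerRank`),
additivity `hF (A × B) = hF A + hF B`, Bost's lower bound `hF A ≥ −(dim A / 2) log(2π²)`, and the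
normalisation `hF A = stableFaltingsHeight W` whenever `A(K̄) ≅ E_W(K̄)` `Γ_K`-equivariantly.
**Faithfulness caveat** (read before using it in a statement): these axioms do *not* determine
`hF` on abelian varieties of dimension `≥ 2` (adding to `hF` any additive, isogeny- and
base-change-invariant non-negative function of the non-elliptic simple factors preserves all of
them), so `∀ T : FaltingsHeightTheory, S T` is in general *stronger* than the classical reading of
`S` (it is implied by, and for statements monotone in the height equivalent to, the classical one
only when `S` uses `hF` through the axioms) and `∃ T, …` is *weaker*; numerical facts about the
height of a specific higher-dimensional variety (e.g. Ullmo's bounds for `J₀(N)`) cannot be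
vendored against this interface.

**Inhabitation is not asserted as a named fact.** An earlier revision of this file declared
`def nonempty_faltingsHeightTheory : Prop := Nonempty FaltingsHeightTheory`; it was withdrawn at
its D-0026/D-0027 review (2026-08-15). The statement is true of the genuine `h_F`, every field
being a published theorem about it, but it is not the transcription of a printed result:
discharging it means *constructing* the stable height in every dimension (Néron models and the
semistable reduction theorem, the Hodge bundle with its `L²`-metric, Lemma 5 for finite flat
group schemes, Bost's lower bound) and, through field
`hF_eq_stableFaltingsHeight`, proving the consequence of Faltings' isogeny theorem recorded in
`FaltingsHeightTheoryProofs` (`stableFaltingsHeight_eq_of_addEquiv_of_nonempty`: any inhabitant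
forces equal stable heights for elliptic curves with `Γ_K`-isomorphic groups of `K̄`-points —
Faltings 1983, §6, proof of Thm. 6, via §5 Cor. 1 and the Remark after Lemma 5, §4). Consumers
take `T : FaltingsHeightTheory` as an explicit hypothesis (CONVENTIONS §9), which is exactly as
strong as the withdrawn fact for `T`-free conclusions; what the tree proves unconditionally about
the fields in dimension one (Bost's bound for the closed formula, invariance under base change
and under `K̄`-isomorphism, dependence on `j` only) is in `FaltingsHeightTheoryProofs` and
`StableFaltingsHeightMapProofs`.

## Design notes

* No new analytic object is introduced: the archimedean term is Mathlib's `ZLattice.covolume`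
  through the tree's `complexPeriod`, whose independence of the chosen lattice, positivity and
  scaling `|u|²` under `ω ↦ uω` are theorems of the tree (`ComplexPeriodProofs`); the finite term
  is the tree's minimal discriminant ideal, whose invariance under changes of variables is a
  theorem of the tree (`MinimalDiscriminantSmulProofs`).
* `Real.log` of a non-positive number is a junk value; all terms are positive for elliptic `W`
  (`complexPeriod_pos'`, `Δ ≠ 0`, norms of non-zero ideals), and singular `W` are never used.
* All curve-level declarations are deliberate dot-notation extensions of Mathlib's
  `WeierstrassCurve` namespace (as in `ComplexPeriod.lean`, `MinimalDiscriminant.lean`); the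
  interface lives in the path namespace `Literature.NumberTheory.DiophantineGeometry`.
* Not here: the proof of Silverman's comparison (needs the fundamental domain of `SL₂(ℤ)` and
  `q`-expansion bounds for `Δ`), `𝔇 ∣ 𝔇_min` and `h_F ≤ h(E/K)`, the Néron–Tate / theta-height
  comparisons, heights of CM curves (Chowla–Selberg).

## References

* [Faltings1986FinitenessTranslation] G. Faltings, *Finiteness theorems for abelian varieties
  over number fields* (transl. of Invent. Math. 73 (1983)), in Cornell–Silverman, *Arithmetic
  Geometry*, Ch. II: §3 (Definition of `h(A)`, p. 14, "invariant under extension of the ground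
  field"), §4 (Lemma 5 and the Remark following it), §5 (Thm. 4, Cor. 1–2), §6 (proof of
  Thm. 6, p. 24: isomorphic Tate modules at `l` give an isogeny of degree prime to `l`, and `l`
  does not occur in `exp(2[K:ℚ](h(B₁) − h(B₂)))`).
* [Silverman1986] J. H. Silverman, *Heights and elliptic curves*, ibid. Ch. X, Prop. 1.1 (p. 254)
  and its proof, §2 (p. 257: `(j) = 𝔄𝔇⁻¹`, `Υ_{E/K}`, Prop. 2.1).
* [PastenShimura2024] H. Pasten, *Shimura curves and the abc conjecture*, J. Number Theory 254
  (2024), §3 (p. 13 of arXiv:1705.09251: `h(E) = −½ log((i/2)∫ ω ∧ ω̄)`), §18.1 (definition over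
  a number field, formula (18.1), Lemma 18.1).
* [GaudronRemondPeriodes2014] É. Gaudron, G. Rémond, *Théorème des périodes et degrés minimaux
  d'isogénies*, Comment. Math. Helv. 89 (2014), §2.3 Déf. 2.1 (normalisations, isogeny inequality,
  additivity), Cor. 8.4 (Bost's lower bound `h(A) ≥ −(dim A/2) log(2π)`).
* [GaudronRemond2023] É. Gaudron, G. Rémond, *Nouveaux théorèmes d'isogénie*, Mém. SMF 176
  (2023), §1.5 (use of `h_F` in Faltings' normalisation).
-/

noncomputable section

open scoped Classical

namespace WeierstrassCurve

/-! ### The archimedean term of a model over `ℂ` -/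

section Complex

variable (V : WeierstrassCurve ℂ)

/-- The **archimedean term** of a Weierstrass model `V` over `ℂ` in Faltings' height:
`log |Δ_V| + 6 · log((i/2) ∫_{E(ℂ)} ω_V ∧ ω̄_V)`, where `ω_V = dx/(2y + a₁x + a₃)` and
`(i/2)∫ ω_V ∧ ω̄_V = covol(Λ_V)` is the Lebesgue covolume of the period lattice of `ω_V`, i.e.
half the tree's `complexPeriod V = ∫ |ω ∧ ω̄| = 2 covol(Λ_V)`. This is `log ‖β‖` for Silverman's
coordinate-invariant section `β = Δ ω^{⊗12}` of `ω^{⊗12}` (Silverman 1986, proof of Prop. 1.1: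
`(i/2)∫ α ∧ ᾱ = |Δ(τ)|^{1/6} Im τ` for `α = Δ(τ)^{1/12} dz`), so it does not depend on the model
(`faltingsArchTerm_smul`). Junk value (`Real.log` of `0`) for singular `V`.
[cite: Silverman1986, Prop. 1.1 and its proof (pp. 254–256)] -/
def faltingsArchTerm : ℝ :=
  Real.log ‖V.Δ‖ + 6 * Real.log (V.complexPeriod / 2)

/-- **Model independence of the archimedean term.** Under a change of variables
`C = (u, r, s, t)`, `Δ ↦ u⁻¹² Δ` (Mathlib `variableChange_Δ`) and `ω ↦ u ω`, so the period lattice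
scales by `u` and `(i/2)∫ ω ∧ ω̄` by `|u|²` (the tree's `complexPeriod_smul_holds`); the two
changes cancel in `log |Δ| + 6 log((i/2)∫ ω ∧ ω̄)` — Silverman's remark that `β = Δ ω^{⊗12}` "is
invariant under the usual change of coordinates". [cite: Silverman1986, proof of Prop. 1.1 (p. 255)] -/
theorem faltingsArchTerm_smul [V.IsElliptic] (C : VariableChange ℂ) :
    (C • V).faltingsArchTerm = V.faltingsArchTerm := by
  have hu : (C.u : ℂ) ≠ 0 := C.u.ne_zero
  have hnu : ‖(C.u : ℂ)‖ ≠ 0 := norm_ne_zero_iff.mpr hu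
  have hΔ : V.Δ ≠ 0 := V.isUnit_Δ.ne_zero
  have hnΔ : ‖V.Δ‖ ≠ 0 := norm_ne_zero_iff.mpr hΔ
  have hcp : 0 < V.complexPeriod := V.complexPeriod_pos'
  have hΔ' : (C • V).Δ = ((C.u : ℂ)⁻¹) ^ 12 * V.Δ := by
    rw [variableChange_Δ]
    push_cast
    ring
  rw [faltingsArchTerm, faltingsArchTerm, hΔ', V.complexPeriod_smul_holds C, norm_mul, norm_pow,
    norm_inv, Real.log_mul (pow_ne_zero _ (inv_ne_zero hnu)) hnΔ, Real.log_pow, Real.log_inv,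
    mul_div_assoc, Real.log_mul (pow_ne_zero _ hnu) (div_pos hcp two_pos).ne', Real.log_pow]
  push_cast
  ring

/-- The archimedean term for a Néron-type period pair: if `g₂(L) = c₄/12`, `g₃(L) = c₆/216`
(`IsNeronLatticeOf V L`), then `faltingsArchTerm V = log |Δ_V| + 6 log covol(L)`
(`complexPeriod V = 2 covol(L)`, the tree's `complexPeriod_eq_two_mul_covolume'`).
[cite: Silverman1986, proof of Prop. 1.1 (p. 256)] -/
theorem faltingsArchTerm_eq_of_isNeronLatticeOf {L : PeriodPair}
    (hL : Literature.NumberTheory.EllipticCurves.ModularForms.IsNeronLatticeOf V L) :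
    V.faltingsArchTerm = Real.log ‖V.Δ‖ + 6 * Real.log (ZLattice.covolume L.lattice) := by
  rw [faltingsArchTerm, V.complexPeriod_eq_two_mul_covolume' hL.1 hL.2,
    mul_div_cancel_left₀ _ (two_ne_zero)]

end Complex

/-! ### The Faltings height of an elliptic curve over a number field -/

section NumberField

open NumberField

variable {K : Type*} [Field K] [NumberField K] (W : WeierstrassCurve K)

/-- **The Faltings height `h(E/K)` of an elliptic curve over a number field `K`**, given by any
Weierstrass model `W` of it (Faltings 1983, §3: `[K:ℚ]⁻¹ · deg` of the Hodge bundle of the Néron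
model of `E/K`, metric `‖α‖² = (i/2)∫_{E_σ(ℂ)} α ∧ ᾱ`), as the closed formula

  `h(E/K) = (12 [K:ℚ])⁻¹ · ( log N(𝔇_min(E/K)) − Σ_{σ : K → ℂ} ( log|σ(Δ_W)| + 6 log((i/2)∫_{E_σ(ℂ)} ω_W ∧ ω̄_W) ) )`

obtained by computing the degree with the invariant section `β = Δ_W ω_W^{⊗12}` (Silverman 1986,
Prop. 1.1 and its proof; Pasten 2024, §18.1 and (18.1): the same formula written with
`τ_σ`, `|Δ(τ_σ)| Im(τ_σ)⁶` and `−log(2π)`). Here `N(𝔇_min)` is the tree's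
`W.minimalDiscriminantNorm (𝓞 K)` and `(i/2)∫ ω ∧ ω̄ = covol(Λ_{W,σ}) = complexPeriod/2`
(`faltingsArchTerm`). This is the height *over `K`* (Pasten: "this is not the semi-stable Faltings
height"; Silverman 1986, Remark 1.2 (1)); see `stableFaltingsHeight` for the stable one. It does
not depend on the model (`faltingsHeight_smul`). For `K = ℚ` and a globally minimal `W` it is
`−½ log((i/2)∫_{E(ℂ)} ω ∧ ω̄)` (`faltingsHeight_eq_neg_half_log`, Pasten 2024 §3). Junk value
for singular `W` (never used). (Dot-notation extension of Mathlib's `WeierstrassCurve`.)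
[cite: Faltings1986FinitenessTranslation, §3 (Definition of h(A))] [cite: Silverman1986, Prop. 1.1 (p. 254)] [cite: PastenShimura2024, §18.1 eq. (18.1)] -/
def faltingsHeight : ℝ :=
  (12 * (Module.finrank ℚ K : ℝ))⁻¹ *
    (Real.log (W.minimalDiscriminantNorm (𝓞 K)) - ∑ σ : K →+* ℂ, (W.map σ).faltingsArchTerm)

/-- **The denominator ideal `𝔇` of the `j`-invariant**: `𝔇 = {a ∈ 𝓞_K | a · j(E) ∈ 𝓞_K}`, the
integral ideal with `(j_E) = 𝔄 𝔇⁻¹`, `𝔄, 𝔇` coprime (Silverman 1986, §2, p. 257). For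
semistable `E/K` one has `𝔇 = Δ_{E/K}` (the minimal discriminant), in general `𝔇 ∣ Δ_{E/K}` with
quotient the *unstable minimal discriminant* `Υ_{E/K}` (loc. cit.); `𝔇` is an isomorphism
invariant (`j` is) and extends along field extensions (`𝔇_{E_L} = 𝔇 𝓞_L`), which is why it
carries the finite part of the *stable* height. It is `⊤` exactly when `j(E)` is an algebraic
integer (`one_mem_jDenominatorIdeal_iff`), e.g. for `j = 0, 1728`.
(Dot-notation extension of Mathlib's `WeierstrassCurve`.) [cite: Silverman1986, §2 (p. 257)] -/
def jDenominatorIdeal [W.IsElliptic] : Ideal (𝓞 K) where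
  carrier := {a | ∃ b : 𝓞 K, (a : K) * W.j = (b : K)}
  add_mem' := by
    rintro a a' ⟨b, hb⟩ ⟨b', hb'⟩
    refine ⟨b + b', ?_⟩
    push_cast
    rw [add_mul, hb, hb']
  zero_mem' := ⟨0, by simp⟩
  smul_mem' := by
    rintro c a ⟨b, hb⟩
    refine ⟨c * b, ?_⟩
    simp only [smul_eq_mul]
    push_cast
    rw [mul_assoc, hb]

omit [NumberField K] in
/-- Membership in the denominator ideal of `j`: `a ∈ 𝔇 ↔ a · j(W) ∈ 𝓞_K`.
[cite: Silverman1986, §2 (p. 257)] -/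
theorem mem_jDenominatorIdeal [W.IsElliptic] (a : 𝓞 K) :
    a ∈ W.jDenominatorIdeal ↔ ∃ b : 𝓞 K, (a : K) * W.j = (b : K) :=
  Iff.rfl

omit [NumberField K] in
/-- The denominator ideal of `j` is an isomorphism invariant of `E/K` (`j(C • W) = j(W)`, Mathlib
`variableChange_j`). [cite: Silverman1986, §2 (p. 257)] -/
theorem jDenominatorIdeal_smul [W.IsElliptic] (C : VariableChange K) :
    (C • W).jDenominatorIdeal = W.jDenominatorIdeal := by
  ext a
  simp only [mem_jDenominatorIdeal, variableChange_j]

omit [NumberField K] in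
/-- `1 ∈ 𝔇 ↔ j(W) ∈ 𝓞_K`, i.e. `𝔇 = ⊤` iff `j(E)` is an algebraic integer (potentially good
reduction everywhere; Silverman 1986, §2). [cite: Silverman1986, §2 (p. 257)] -/
theorem one_mem_jDenominatorIdeal_iff [W.IsElliptic] :
    (1 : 𝓞 K) ∈ W.jDenominatorIdeal ↔ ∃ b : 𝓞 K, W.j = (b : K) := by
  simp [mem_jDenominatorIdeal]

/-- The denominator ideal of `j` is non-zero: `K` is the fraction field of `𝓞_K`, so
`j = a / b` with `a, b ∈ 𝓞_K`, `b ≠ 0`, and then `b ∈ 𝔇` (Mathlib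
`IsFractionRing.div_surjective`). [folklore] -/
theorem jDenominatorIdeal_ne_bot [W.IsElliptic] : W.jDenominatorIdeal ≠ ⊥ := by
  obtain ⟨a, b, hb, hab⟩ := IsFractionRing.div_surjective (A := 𝓞 K) W.j
  have hb0 : b ≠ 0 := nonZeroDivisors.ne_zero hb
  have hbK : algebraMap (𝓞 K) K b ≠ 0 := fun h =>
    hb0 (IsFractionRing.injective (𝓞 K) K (by rw [h, map_zero]))
  rw [Submodule.ne_bot_iff]
  refine ⟨b, ⟨a, ?_⟩, hb0⟩
  rw [← hab, RingOfIntegers.coe_eq_algebraMap, RingOfIntegers.coe_eq_algebraMap,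
    mul_div_cancel₀ _ hbK]

/-- **The stable Faltings height `h_F(E)` of an elliptic curve** over a number field `K`, given by
any Weierstrass model `W`: `h_F(E) = h(E_L/L)` for any finite `L/K` over which `E` has semistable
reduction everywhere (Faltings 1983, §3: the height of a semiabelian model, "invariant under
extension of the ground field"; Gaudron–Rémond 2014, Déf. 2.1 with `h_F = h − ½ log π`;
Gaudron–Rémond 2023, §1.5). By Silverman 1986, Prop. 1.1 over `L` and §2 (for semistable `E_L/L`
the minimal discriminant is the denominator ideal `𝔇_{E_L} = 𝔇 𝓞_L` of `j`, of norm
`N(𝔇)^{[L:K]}`, while each `σ : K → ℂ` has `[L:K]` extensions to `L`), this is the closed formula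

  `h_F(E) = (12 [K:ℚ])⁻¹ · ( log N(𝔇) − Σ_{σ : K → ℂ} ( log|σ(Δ_W)| + 6 log((i/2)∫_{E_σ(ℂ)} ω_W ∧ ω̄_W) ) )`

with `𝔇 = jDenominatorIdeal W`, which we take as the definition. It is model-independent
(`stableFaltingsHeight_smul`) and equals `faltingsHeight W` when `E/K` is semistable
(`𝔇 = 𝔇_min`). Junk value for singular `W`. (Dot-notation extension of Mathlib's
`WeierstrassCurve`.)
[cite: Faltings1986FinitenessTranslation, §3 (Definition of h(A))] [cite: Silverman1986, Prop. 1.1 and §2 (pp. 254, 257)] [cite: GaudronRemondPeriodes2014, Déf. 2.1] -/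
def stableFaltingsHeight [W.IsElliptic] : ℝ :=
  (12 * (Module.finrank ℚ K : ℝ))⁻¹ *
    (Real.log (Ideal.absNorm W.jDenominatorIdeal) - ∑ σ : K →+* ℂ, (W.map σ).faltingsArchTerm)

/-- **Model independence of `h(E/K)`.** For a change of variables `C` over `K`, the minimal
discriminant ideal is unchanged (the tree's `minimalDiscriminantIdeal_smul_holds`, Silverman
*AEC* VII.1.3(b)) and so is each archimedean term (`faltingsArchTerm_smul`, since
`(C • W).map σ = C.map σ • W.map σ`). [cite: Silverman1986, Prop. 1.1 (independence of the Weierstrass equation, proof p. 255)] -/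
theorem faltingsHeight_smul [W.IsElliptic] (C : VariableChange K) :
    (C • W).faltingsHeight = W.faltingsHeight := by
  unfold faltingsHeight minimalDiscriminantNorm
  rw [minimalDiscriminantIdeal_smul_holds (𝓞 K) W C]
  congr 2
  refine Finset.sum_congr rfl fun σ _ => ?_
  rw [← map_variableChange, faltingsArchTerm_smul]

/-- **Model independence of `h_F(E)`** (`j` and the archimedean terms are invariant).
[cite: Silverman1986, Prop. 1.1 and §2] -/
theorem stableFaltingsHeight_smul [W.IsElliptic] (C : VariableChange K) :
    (C • W).stableFaltingsHeight = W.stableFaltingsHeight := by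
  unfold stableFaltingsHeight
  rw [jDenominatorIdeal_smul]
  congr 2
  refine Finset.sum_congr rfl fun σ _ => ?_
  rw [← map_variableChange, faltingsArchTerm_smul]

end NumberField

/-! ### Over `ℚ`: globally minimal models and the Néron lattice -/

section Rat

open NumberField Literature.NumberTheory.EllipticCurves.ModularForms

variable (W : WeierstrassCurve ℚ)

/-- Over `ℚ` the sum over embeddings has the single term `σ = (ℚ → ℂ)` and `[ℚ:ℚ] = 1`:
`12 h(E/ℚ) = log |Δ_min| − log|Δ_W| − 6 log((i/2)∫ ω_W ∧ ω̄_W)` (with the tree's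
`minimalDiscriminantNorm_ringOfIntegers_rat_holds` to pass from `𝓞 ℚ` to `ℤ`).
[cite: Silverman1986, Prop. 1.1 (p. 254)] -/
theorem faltingsHeight_rat :
    W.faltingsHeight = (12 : ℝ)⁻¹ *
      (Real.log (W.minimalDiscriminantNorm ℤ) - (W.baseChange ℂ).faltingsArchTerm) := by
  unfold faltingsHeight
  rw [minimalDiscriminantNorm_ringOfIntegers_rat_holds W, Module.finrank_self, Nat.cast_one,
    mul_one, Fintype.sum_subsingleton _ (algebraMap ℚ ℂ)]
  rfl

/-- **`h(E) = −½ log((i/2)∫_{E(ℂ)} ω ∧ ω̄)` for a global minimal model over `ℚ`** (Pasten 2024,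
§3, p. 13: "for `ω_E` a global Néron differential of `E` we have
`h(E) = −½ log((i/2)∫_{E(ℂ)} ω_E ∧ ω̄_E)`"): for `[W.IsGloballyMinimal]` the minimal discriminant
is `|Δ_W|` (the tree's `minimalDiscriminantNorm_int_eq_natAbs_minimalDiscriminantInt_holds` and
`cast_minimalDiscriminantInt`), which cancels the `log|Δ_W|` of the archimedean term, leaving
`−(6/12) log(complexPeriod/2)`. [cite: PastenShimura2024, §3 (p. 13)] -/
theorem faltingsHeight_eq_neg_half_log [W.IsElliptic] [W.IsGloballyMinimal] :
    W.faltingsHeight = -(1 / 2) * Real.log ((W.baseChange ℂ).complexPeriod / 2) := by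
  rw [faltingsHeight_rat, minimalDiscriminantNorm_int_eq_natAbs_minimalDiscriminantInt_holds W,
    faltingsArchTerm]
  have hΔ : ‖(W.baseChange ℂ).Δ‖ = ((minimalDiscriminantInt W).natAbs : ℝ) := by
    rw [baseChange, map_Δ, ← cast_minimalDiscriminantInt W, eq_ratCast, Rat.cast_intCast,
      Complex.norm_intCast, Nat.cast_natAbs, Int.cast_abs]
  rw [hΔ]
  ring

/-- **`h(E) = −½ log covol(Λ_E)`**: for a global minimal model `W/ℚ` and any period pair `L`
spanning the period lattice of its (Néron) differential (`IsNeronLatticeOf (W.baseChange ℂ) L`,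
i.e. `g₂(L) = c₄/12`, `g₃(L) = c₆/216`), `h(E) = −½ log(ZLattice.covolume L.lattice)`, the
covolume being `(i/2)∫_{E(ℂ)} ω ∧ ω̄` (Silverman 1986, proof of Prop. 1.1: "the area of a
fundamental parallelogram"; Pasten 2024 §3). [cite: PastenShimura2024, §3 (p. 13)] -/
theorem faltingsHeight_eq_neg_half_log_covolume [W.IsElliptic] [W.IsGloballyMinimal]
    {L : PeriodPair} (hL : IsNeronLatticeOf (W.baseChange ℂ) L) :
    W.faltingsHeight = -(1 / 2) * Real.log (ZLattice.covolume L.lattice) := by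
  rw [faltingsHeight_eq_neg_half_log,
    (W.baseChange ℂ).complexPeriod_eq_two_mul_covolume' hL.1 hL.2,
    mul_div_cancel_left₀ _ two_ne_zero]

end Rat

end WeierstrassCurve

namespace Literature.NumberTheory.EllipticCurves.ModularForms.ModularParametrizationData

open scoped MatrixGroups ModularForm
open CongruenceSubgroup

variable {W : WeierstrassCurve ℚ} {N : ℕ} [NeZero N]

/-- **Compatibility with modular parametrisation data.** For a global minimal model `W/ℚ` and a
parametrisation datum `D` (whose `D.L` is a Néron-type period pair of `W`, field
`isNeronLattice`), `h(E) = −½ log covol(Λ_E)` with `Λ_E = D.L.lattice` — the quantity in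
Zagier's formula `4π² c² (f,f) = deg φ · covol(Λ_E)` (`zagier_degree_formula`, proved in the
tree), so that degree bounds convert into height bounds. [cite: PastenShimura2024, §3 (p. 13)] -/
theorem faltingsHeight_eq [W.IsElliptic] [W.IsGloballyMinimal]
    (D : ModularParametrizationData W N) :
    W.faltingsHeight = -(1 / 2) * Real.log (ZLattice.covolume D.L.lattice) :=
  W.faltingsHeight_eq_neg_half_log_covolume D.isNeronLattice

/-- **Frey's identity** (Pasten 2024, §3, display after Conj. 3.1, attributed to Frey 1989):
pulling back `ω ∧ ω̄` along the modular parametrisation gives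
`log deg φ = 2 log(2π c) + 2 log ‖f‖ + 2 h(E)`, i.e. `2 h(E) = log deg φ − log(4π² c² (f,f))`,
for a global minimal `W/ℚ` with parametrisation datum `D` of Manin constant `c` and newform `f`
(`(f,f) = ∬_{Γ₀(N)\ℍ} |f|² du dv`, the tree's `peterssonProduct`). Real proof from Zagier's
formula (the tree's `zagier_degree_formula_holds`) and `faltingsHeight_eq`.
[cite: PastenShimura2024, §3 (identity after Conj. 3.1)] -/
theorem two_mul_faltingsHeight_eq [W.IsElliptic] [W.IsGloballyMinimal]
    (D : ModularParametrizationData W N) :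
    2 * W.faltingsHeight = Real.log D.modularDegree -
      Real.log (4 * Real.pi ^ 2 * (D.maninConstant : ℝ) ^ 2 *
        (peterssonProduct (Gamma0 N) 2 D.f D.f).re) := by
  simp only [modularDegree, maninConstant]
  have hz := D.zagier_degree_formula_holds
  have hre := congrArg Complex.re hz
  rw [Complex.re_ofReal_mul, Complex.ofReal_re] at hre
  -- `hre : 4π²c² · (f,f).re = deg · covol`
  have hdeg : (0 : ℝ) < D.deg := by exact_mod_cast D.deg_pos
  have hcov : 0 < ZLattice.covolume D.L.lattice := ZLattice.covolume_pos _ _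
  rw [D.faltingsHeight_eq, ← mul_assoc, hre, Real.log_mul hdeg.ne' hcov.ne']
  ring

end Literature.NumberTheory.EllipticCurves.ModularForms.ModularParametrizationData

/-! ### Named facts about the height of elliptic curves -/

namespace WeierstrassCurve

open NumberField

/-- **Silverman's comparison with the minimal discriminant** (Pasten 2024, Lemma 18.1, deduced
from Silverman 1986, Prop. 1.1 / §2): for an elliptic curve `E` over a number field `L`,
`[L:ℚ]⁻¹ · log N(𝔇_min(E/L)) < 12 h(E/L) + 16` (for `L = ℚ`: `log|Δ_min| ≤ 12 h(E) + 16`,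
Pasten 2024 §3, the inequality by which a modular-degree bound becomes a Szpiro bound). Named
fact (D-0014): the proof needs the fundamental domain of `SL₂(ℤ)` and bounds for `Δ(τ)` there.
[cite: PastenShimura2024, Lemma 18.1] -/
def log_minimalDiscriminantNorm_lt_faltingsHeight : Prop :=
  ∀ {L : Type} [Field L] [NumberField L] (W : WeierstrassCurve L) [W.IsElliptic],
    (Module.finrank ℚ L : ℝ)⁻¹ * Real.log (W.minimalDiscriminantNorm (𝓞 L)) <
      12 * W.faltingsHeight + 16

/-- **Faltings' isogeny inequality for stable heights of elliptic curves**: for an isogeny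
`φ : E → E'` defined over the number field `K`, `h_F(E') ≤ h_F(E) + ½ log deg φ` (Faltings 1983,
§4, Lemma 5: `h(A₂) = h(A₁) + ½ log deg φ − [K:ℚ]⁻¹ log #s^*Ω¹_{G/R}` over a field of semistable
reduction, the last term being `≥ 0`; stated for the stable height in any normalisation in
Gaudron–Rémond 2014, §2.3). Applied to `φ` and its dual it gives `|h_F(E) − h_F(E')| ≤ ½ log deg φ`.
Here `φ.degree = #ker φ` on `K̄`-points, the degree in characteristic `0`. Named fact (D-0014).
[cite: Faltings1986FinitenessTranslation, §4 Lemma 5] [cite: GaudronRemondPeriodes2014, §2.3] -/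
def stableFaltingsHeight_le_of_isogeny : Prop :=
  ∀ {K : Type} [Field K] [NumberField K] (W W' : WeierstrassCurve K) [W.IsElliptic]
    [W'.IsElliptic] (φ : Isogeny W W'),
    W'.stableFaltingsHeight ≤ W.stableFaltingsHeight + (1 / 2) * Real.log φ.degree

/-- **Invariance of the stable height under base change** (Faltings 1983, §3: `h(A)` "is
invariant under extension of the ground field"; Pasten 2024, §18.1: "when `A` is semi-stable
over `L` then `h(A)` is invariant under base change"): for a finite extension of number fields
`L/K`, `h_F(E ⊗_K L) = h_F(E)`. With the closed formula this is the multiplicativity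
`N(𝔇 𝓞_L) = N(𝔇)^{[L:K]}` of the denominator ideal of `j` together with the fact that each
embedding `K → ℂ` has `[L:K]` extensions to `L`. Named fact (D-0014).
[cite: Faltings1986FinitenessTranslation, §3 (remark after the Definition)] -/
def stableFaltingsHeight_map : Prop :=
  ∀ {K : Type} [Field K] [NumberField K] {L : Type} [Field L] [NumberField L] [Algebra K L]
    (W : WeierstrassCurve K) [W.IsElliptic],
    (W.map (algebraMap K L)).stableFaltingsHeight = W.stableFaltingsHeight

end WeierstrassCurve

/-! ### Abelian varieties: the interface -/

namespace Literature.NumberTheory.DiophantineGeometry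

open CategoryTheory Literature.AlgebraicGeometry.Motives

/-- **Interface for the stable Faltings height on abelian varieties over number fields**
(hypothesis structure, CONVENTIONS §9). A term `T : FaltingsHeightTheory` is a real-valued
function `T.hF` on abelian varieties over number fields (the tree's
`Literature.AlgebraicGeometry.Motives.AbelianVariety`, universe `0`) with the properties of the
stable Faltings height `h_F` — Faltings 1983, §3, normalisation `‖α‖² = (i/2)^g ∫ α ∧ ᾱ` — that
statements consume, each being a published theorem about `h_F`:

* `hF_eq_of_iso`, `hF_baseChange`: `h_F` is an invariant of the isomorphism class and of the base
  change to a finite extension (Faltings 1983, §3);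
* `hF_le_of_isIsogeny`: `h_F(B) ≤ h_F(A) + ½ log deg φ` for an isogeny `φ : A → B` (Faltings 1983,
  §4, Lemma 5; Gaudron–Rémond 2014, §2.3), `deg φ = Hom.kerRank φ` (the order of the kernel group
  scheme, Görtz–Wedhorn II, Cor. 27.177);
* `hF_prod`: `h_F(A × B) = h_F(A) + h_F(B)` (Gaudron–Rémond 2014, §2.3);
* `hF_ge`: Bost's lower bound `h_F(A) ≥ −(dim A / 2) · log(2π²)` (Gaudron–Rémond 2014, Cor. 8.4:
  `h(A) ≥ −(dim A/2) log(2π)` for `h = h_F + (dim A/2) log π`);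
* `hF_eq_stableFaltingsHeight`: on elliptic curves `T.hF` is the closed formula
  `WeierstrassCurve.stableFaltingsHeight` (Silverman 1986, Prop. 1.1): if `A(K̄) ≅ E_W(K̄)` as
  `Γ_K`-modules then `hF A = stableFaltingsHeight W`. **This field has the strength of Faltings'
  isogeny theorem**: for the genuine `h_F` it holds because such an `A` is an elliptic curve over
  `K` (its torsion is `(ℚ/ℤ)²`) with `T_ℓ A ≅ T_ℓ E_W` as `Γ_K`-modules for every `ℓ`, whence,
  by the step printed in Faltings 1983, §6, proof of Thm. 6 (p. 24) — §5 Thm. 4 / Cor. 1 give a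
  `K`-isogeny `A → E_W` of degree prime to `ℓ`, so by the Remark after Lemma 5 (§4) the prime `ℓ`
  does not occur in the rational number `exp(2[K:ℚ](h(A) − h(E_W)))` — applied to every `ℓ`,
  `h_F(A) = h_F(E_W)`. The hypothesis is an isomorphism of abstract Galois modules (the shape of
  the tree's bridge data `WeierstrassCurve.AbelianVarietyBridge`), not of abelian varieties; see
  `FaltingsHeightTheoryProofs` (`stableFaltingsHeight_eq_of_addEquiv_of_nonempty`) for what it
  forces on pairs of Weierstrass curves.

**Faithfulness caveat.** The fields do not determine `hF` on abelian varieties of dimension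
`≥ 2`: if `F` is any non-negative function of isogeny classes of non-elliptic simple abelian
varieties, additive on products and invariant under base change, then `hF + F` again satisfies
every field. Consequently a statement `∀ T : FaltingsHeightTheory, S T` is implied by — and may
be strictly stronger than — the classical statement `S(h_F)`, while `∃ T, S T` may be strictly
weaker; only uses of `hF` *through the listed properties* are faithful, and numerical facts on the
height of specific higher-dimensional varieties cannot be stated against this interface. A real
definition needs Néron models with their Hodge bundle and integration on `A(ℂ)`, absent from
Mathlib; the inhabitation `Nonempty FaltingsHeightTheory` (true of the genuine `h_F`) is
deliberately **not** a named fact of the tree — it is the existence of the whole theory, not a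
printed theorem (see the module docstring) — and consumers take `T : FaltingsHeightTheory` as a
hypothesis.
[cite: Faltings1986FinitenessTranslation, §3 (Definition of h(A)), §4 (Lemma 5), §6 (proof of Thm. 6)] [cite: GaudronRemondPeriodes2014, §2.3 and Cor. 8.4] [cite: Silverman1986, Prop. 1.1] -/
structure FaltingsHeightTheory where
  /-- The stable Faltings height `h_F(A)` of an abelian variety over a number field. -/
  hF : ∀ {K : Type} [Field K] [NumberField K], AbelianVariety.{0} K → ℝ
  /-- Isomorphic abelian varieties have the same height. -/
  hF_eq_of_iso : ∀ {K : Type} [Field K] [NumberField K] {A B : AbelianVariety.{0} K},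
    (A ≅ B) → hF A = hF B
  /-- The stable height is invariant under base change to a finite extension. -/
  hF_baseChange : ∀ {K : Type} [Field K] [NumberField K] {L : Type} [Field L] [NumberField L]
    [Algebra K L] (A : AbelianVariety.{0} K), hF (A.baseChange L) = hF A
  /-- Faltings' isogeny inequality `h_F(B) ≤ h_F(A) + ½ log deg φ`. -/
  hF_le_of_isIsogeny : ∀ {K : Type} [Field K] [NumberField K] {A B : AbelianVariety.{0} K}
    (φ : A ⟶ B), AbelianVariety.IsIsogeny φ →
      hF B ≤ hF A + (1 / 2) * Real.log (AbelianVariety.Hom.kerRank φ)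
  /-- Additivity `h_F(A × B) = h_F(A) + h_F(B)`. -/
  hF_prod : ∀ {K : Type} [Field K] [NumberField K] (A B : AbelianVariety.{0} K),
    hF (A.prod B) = hF A + hF B
  /-- Bost's lower bound `h_F(A) ≥ −(dim A / 2) log(2π²)`. -/
  hF_ge : ∀ {K : Type} [Field K] [NumberField K] (A : AbelianVariety.{0} K),
    -((A.dim : ℝ) / 2) * Real.log (2 * Real.pi ^ 2) ≤ hF A
  /-- Normalisation: on elliptic curves `hF` is `WeierstrassCurve.stableFaltingsHeight`. -/
  hF_eq_stableFaltingsHeight : ∀ {K : Type} [Field K] [NumberField K] (W : WeierstrassCurve K)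
    [W.IsElliptic] (A : AbelianVariety.{0} K) (e : A.geomPoints ≃+ W.geomPoints),
    (∀ (σ : Field.absoluteGaloisGroup K) (P : A.geomPoints), e (σ • P) = σ • e P) →
      hF A = W.stableFaltingsHeight

namespace FaltingsHeightTheory

variable (T : FaltingsHeightTheory) {K : Type} [Field K] [NumberField K]

/-- **`|h_F(A) − h_F(B)| ≤ ½ log deg φ`** for isogenies `φ : A → B`, `ψ : B → A` of the same
degree (e.g. an isogeny of elliptic curves and its dual): the two-sided form of Faltings' Lemma 5
used by Pasten 2024, §3 (`|h(A_{1,N}) − h(E)| ≤ ½ log 163`). Immediate from `hF_le_of_isIsogeny`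
applied to `φ` and to `ψ`. [cite: Faltings1986FinitenessTranslation, §4 Lemma 5] -/
theorem abs_hF_sub_hF_le {A B : AbelianVariety.{0} K} (φ : A ⟶ B) (ψ : B ⟶ A)
    (hφ : AbelianVariety.IsIsogeny φ) (hψ : AbelianVariety.IsIsogeny ψ)
    (hdeg : AbelianVariety.Hom.kerRank ψ = AbelianVariety.Hom.kerRank φ) :
    |T.hF A - T.hF B| ≤ (1 / 2) * Real.log (AbelianVariety.Hom.kerRank φ) := by
  have h₁ := T.hF_le_of_isIsogeny φ hφ
  have h₂ := T.hF_le_of_isIsogeny ψ hψ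
  rw [hdeg] at h₂
  rw [abs_sub_le_iff]
  constructor <;> linarith

/-- Additivity iterated: `h_F(Aⁿ⁺¹) = h_F(Aⁿ × A) = (n+1) h_F(A)` in the form
`hF (A.prod A) = 2 hF A`. [cite: GaudronRemondPeriodes2014, §2.3] -/
theorem hF_prod_self (A : AbelianVariety.{0} K) : T.hF (A.prod A) = 2 * T.hF A := by
  rw [T.hF_prod, two_mul]

/-- Bost's bound in the crude form `h_F(A) + (3/2) dim A ≥ 0` used by Gaudron–Rémond 2023
(Ch. 16, proof of Lemme 16.2: "en tenant compte de l'inégalité de Bost"), since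
`½ log(2π²) < 3/2`. [cite: GaudronRemond2023, Ch. 16, proof of Lemme 16.2] -/
theorem hF_add_three_halves_dim_nonneg (A : AbelianVariety.{0} K) :
    0 ≤ T.hF A + (3 / 2) * A.dim := by
  have h := T.hF_ge A
  have hlog : Real.log (2 * Real.pi ^ 2) ≤ 3 := by
    have hπ2 : Real.pi ^ 2 < 3.15 ^ 2 := by
      gcongr
      exact Real.pi_lt_d2
    have h20 : 2 * Real.pi ^ 2 ≤ 20 := by nlinarith
    have hexp : (20 : ℝ) ≤ Real.exp 3 := by
      refine le_trans ?_ (Real.sum_le_exp_of_nonneg (by norm_num : (0 : ℝ) ≤ 3) 9)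
      simp only [Finset.sum_range_succ, Finset.sum_range_zero, Nat.factorial]
      norm_num
    calc Real.log (2 * Real.pi ^ 2) ≤ Real.log 20 := Real.log_le_log (by positivity) h20
      _ ≤ 3 := by rwa [Real.log_le_iff_le_exp (by norm_num)]
  have hdim : (0 : ℝ) ≤ A.dim := Nat.cast_nonneg _
  nlinarith

end FaltingsHeightTheory

end Literature.NumberTheory.DiophantineGeometry

end
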